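import Literature.NumberTheory.LFunctions.SiegelZeroHarmonicWeight
import HarnessLib

/-!
# At a Siegel zero the sifted Euler product of `ζ L(·, χ)` at `1` is `≪ 1/(η log q)`

Topic `Literature/NumberTheory/LFunctions`, sub-namespace `SiegelZero`.  Everything here is PROVED
(theorems only).  If the primitive quadratic `χ (mod q)` has the real zero `1 − 1/(η log q)` with `η`
large, then for every `M > q^{(1+ε)/2} + 1`

  `L(1, χ) · ∏_{p < M} (1 − 1/p)(1 − χ(p)/p) ≤ 4/(η log q)`

(`SiegelZero.exists_LFunction_one_mul_siftedEuler_le`).  The left-hand side is the density one expects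
for the divisor sum `λ = 1 ∗ χ` on the integers free of prime factors `< M` (total mass `L(1,χ)` per
unit length, local correction `(1 − 1/p)(1 − χ(p)/p)` at each sifted prime); the bound says that at an
exceptional zero this sifted density is `≪ 1/(η log q)`, uniformly in the sifting level, which is the
quantitative form of "`λ` mimics the primes".  It is an immediate consequence of two displays of the
proof of Proposition 3.5 of Tao–Teräväinen (J. London Math. Soc. 106 (2022), arXiv:2109.06291, §3.3):
(3.15) "`∑_{n ≤ q_χ^{(1+ε)/2}} (1∗χ)(n)/n ≫ L(1,χ) η log q_χ`" (in the tree: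
`SiegelZero.exists_abs_harmSum_sub_le` with `SiegelZero.exists_deriv_LFunction_one_ge`, giving the
explicit `≥ (η log q/4) L(1,χ)`) and "the non-negativity and multiplicativity of `1 ∗ χ`" in the form
`∑_{n ≤ N} (1∗χ)(n)/n ≤ ∏_{p < M} (1 − 1/p)⁻¹(1 − χ(p)/p)⁻¹` for `N < M`
(`SmoothEulerProduct.sum_le_smoothProduct`).

## References

* T. Tao, J. Teräväinen, *The Hardy–Littlewood–Chowla conjecture in the presence of a Siegel zero*,
  J. London Math. Soc. (2) 106 (2022), §3.3, proof of Proposition 3.5, (3.12) and (3.15).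
  [cite: TaoTeravainen2021, §3.3 (3.15)]
* H. L. Montgomery, R. C. Vaughan, *Multiplicative Number Theory I*, §11.2. [MontgomeryVaughan2007]
-/

noncomputable section

open Finset
open Literature.NumberTheory.LFunctions

namespace Literature.NumberTheory.LFunctions.SiegelZero

/-- **(3.15) of Tao–Teräväinen, explicit form.**  For `ε > 0` there is `η₀` such that for every primitive
quadratic `χ (mod q)` with `L(1 − 1/(η log q), χ) = 0`, `η ≥ η₀`, and every integer `N ≥ q^{(1+ε)/2}`:
`(η log q/4) L(1, χ) ≤ ∑_{n ≤ N} (1∗χ)(n)/n` (and `L(1,χ) > 0`).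
[cite: TaoTeravainen2021, §3.3 (3.15)] -/
theorem exists_harmSum_ge_mul_LFunction_one {ε : ℝ} (hε : 0 < ε) :
    ∃ η₀ : ℝ, ∀ (q : ℕ) [NeZero q] (χ : DirichletCharacter ℂ q), χ.IsPrimitive → χ ^ 2 = 1 →
      ∀ η : ℝ, η₀ ≤ η → χ.LFunction ((1 - 1 / (η * Real.log q) : ℝ) : ℂ) = 0 →
        ∀ N : ℕ, (q : ℝ) ^ ((1 + ε) / 2) ≤ N →
          0 < (χ.LFunction 1).re ∧
            η * Real.log q / 4 * (χ.LFunction 1).re ≤ ∑ n ∈ Icc 1 N, (χ.zetaMul n).re / n := by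
  obtain ⟨η₁, h₁⟩ := exists_abs_harmSum_sub_le (ε := ε) hε
  obtain ⟨η₂, h₂⟩ := exists_deriv_LFunction_one_ge
  refine ⟨max (max η₁ η₂) 8, fun q _ χ hprim hq2 η hη hL N hN => ?_⟩
  have hη₁ : η₁ ≤ η := ((le_max_left _ _).trans (le_max_left _ _)).trans hη
  have hη₂ : η₂ ≤ η := ((le_max_right _ _).trans (le_max_left _ _)).trans hη
  have hη8 : 8 ≤ η := (le_max_right _ _).trans hη
  have hq : 2 ≤ q := two_le_of_LFunction_eq_zero hL
  have hχ : χ ≠ 1 := CharacterTails.ne_one_of_isPrimitive χ hprim hq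
  have hqr : (2 : ℝ) ≤ q := by exact_mod_cast hq
  have hq1 : (1 : ℝ) ≤ q := by linarith
  have hlog2 : (1 : ℝ) / 2 < Real.log 2 := by have := Real.log_two_gt_d9; linarith
  have hlogq : Real.log 2 ≤ Real.log q := Real.log_le_log (by norm_num) hqr
  have hηlq : 4 ≤ η * Real.log q := by nlinarith
  obtain ⟨hderiv, hLpos⟩ := h₂ q χ hχ hq2 η hη₂ hL
  have habs := h₁ q χ hprim hq2 η hη₁ hL N hN
  refine ⟨hLpos, ?_⟩
  set L₁ : ℝ := (χ.LFunction 1).re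
  set L₁' : ℝ := (deriv χ.LFunction 1).re
  set γ : ℝ := Real.eulerMascheroniConstant
  have hγ0 : 0 < γ := lt_trans (by norm_num) Real.one_half_lt_eulerMascheroniConstant
  have hN1 : (1 : ℝ) ≤ N := (Real.one_le_rpow hq1 (by positivity)).trans hN
  have hlogN : 0 ≤ Real.log N := Real.log_nonneg hN1
  have hlow := (abs_le.mp habs).1
  -- `G(N) ≥ L' + (log N + γ) L - L ≥ (η log q/2 - 1) L ≥ (η log q/4) L`
  have h3 : (η * Real.log q / 2 - 1) * L₁ ≤ ∑ n ∈ Icc 1 N, (χ.zetaMul n).re / n := by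
    nlinarith
  nlinarith

/-- **The sifted Euler product at an exceptional zero.**  For `ε > 0` there is `η₀` such that for every
primitive quadratic `χ (mod q)` with `L(1 − 1/(η log q), χ) = 0`, `η ≥ η₀`, and every natural `M` with
`q^{(1+ε)/2} + 1 ≤ M`:
`L(1, χ) ∏_{p < M} (1 − 1/p)(1 − χ(p)/p) ≤ 4/(η log q)`.
[cite: TaoTeravainen2021, §3.3 (3.15) (with the Euler-product majorant of `∑ (1∗χ)(n)/n`)] -/
theorem exists_LFunction_one_mul_siftedEuler_le {ε : ℝ} (hε : 0 < ε) :
    ∃ η₀ : ℝ, ∀ (q : ℕ) [NeZero q] (χ : DirichletCharacter ℂ q), χ.IsPrimitive → χ ^ 2 = 1 →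
      ∀ η : ℝ, η₀ ≤ η → χ.LFunction ((1 - 1 / (η * Real.log q) : ℝ) : ℂ) = 0 →
        ∀ M : ℕ, (q : ℝ) ^ ((1 + ε) / 2) + 1 ≤ M →
          (χ.LFunction 1).re *
              ∏ p ∈ M.primesBelow, ((1 - (p : ℝ)⁻¹) * (1 - (χ p).re * (p : ℝ)⁻¹)) ≤
            4 / (η * Real.log q) := by
  obtain ⟨η₀, H⟩ := exists_harmSum_ge_mul_LFunction_one (ε := ε) hε
  refine ⟨η₀, fun q _ χ hprim hq2 η hη hL M hM => ?_⟩
  have hq : 2 ≤ q := two_le_of_LFunction_eq_zero hL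
  have hqr : (2 : ℝ) ≤ q := by exact_mod_cast hq
  have hq1 : (1 : ℝ) ≤ q := by linarith
  have hpow1 : (1 : ℝ) ≤ (q : ℝ) ^ ((1 + ε) / 2) := Real.one_le_rpow hq1 (by positivity)
  have hM2 : (2 : ℝ) ≤ M := by linarith
  have hM2' : 2 ≤ M := by exact_mod_cast hM2
  -- `N = M - 1`
  obtain ⟨N, rfl⟩ : ∃ N, M = N + 1 := ⟨M - 1, by omega⟩
  have hN : (q : ℝ) ^ ((1 + ε) / 2) ≤ N := by
    have : ((N + 1 : ℕ) : ℝ) = (N : ℝ) + 1 := by push_cast; ring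
    rw [this] at hM
    linarith
  obtain ⟨hLpos, hG⟩ := H q χ hprim hq2 η hη hL N hN
  -- the Euler-product majorant
  have hP := SmoothEulerProduct.sum_le_smoothProduct χ hq2 (x := N) (M := N + 1) (Nat.lt_succ_self N)
  set L₁ : ℝ := (χ.LFunction 1).re with hL₁
  set G : ℝ := ∑ n ∈ Icc 1 N, (χ.zetaMul n).re / n with hGdef
  set P : ℝ := ∏ p ∈ (N + 1).primesBelow, (1 - (p : ℝ)⁻¹)⁻¹ * (1 - (χ p).re * (p : ℝ)⁻¹)⁻¹ with hPdef
  -- positivity of the factors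
  have hfac : ∀ p ∈ (N + 1).primesBelow, 0 < (1 - (p : ℝ)⁻¹) * (1 - (χ p).re * (p : ℝ)⁻¹) := by
    intro p hp
    have hpp := Nat.prime_of_mem_primesBelow hp
    have hp1 : (1 : ℝ) < p := by exact_mod_cast hpp.one_lt
    have hp0 : (0 : ℝ) < p := by linarith
    have hinv : (p : ℝ)⁻¹ < 1 := inv_lt_one_of_one_lt₀ hp1
    have hinv0 : 0 ≤ (p : ℝ)⁻¹ := by positivity
    refine mul_pos (by linarith) ?_
    have : (χ p).re * (p : ℝ)⁻¹ ≤ 1 * (p : ℝ)⁻¹ :=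
      mul_le_mul_of_nonneg_right ((le_abs_self _).trans
        (SmoothEulerProduct.abs_apply_re_le_one χ p)) hinv0
    linarith
  have hprod : ∏ p ∈ (N + 1).primesBelow, ((1 - (p : ℝ)⁻¹) * (1 - (χ p).re * (p : ℝ)⁻¹)) = P⁻¹ := by
    rw [hPdef, ← Finset.prod_inv_distrib]
    refine Finset.prod_congr rfl fun p hp => ?_
    rw [mul_inv, inv_inv, inv_inv]
  have hprod0 : 0 < ∏ p ∈ (N + 1).primesBelow, ((1 - (p : ℝ)⁻¹) * (1 - (χ p).re * (p : ℝ)⁻¹)) :=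
    Finset.prod_pos hfac
  have hP0 : 0 < P := by
    have : P = (∏ p ∈ (N + 1).primesBelow, ((1 - (p : ℝ)⁻¹) * (1 - (χ p).re * (p : ℝ)⁻¹)))⁻¹ := by
      rw [hprod, inv_inv]
    rw [this]; exact inv_pos.mpr hprod0
  -- `η log q > 0`
  have hχ1 : χ ≠ 1 := CharacterTails.ne_one_of_isPrimitive χ hprim hq
  have hη0 : 0 < η := eta_pos_of_LFunction_eq_zero χ hχ1 hL
  have hlogq : 0 < Real.log q := Real.log_pos (by linarith)
  have hηlq0 : 0 < η * Real.log q := mul_pos hη0 hlogq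
  rw [hprod]
  have hGP : G ≤ P := hP
  have h1 : L₁ ≤ 4 * P / (η * Real.log q) := by
    rw [le_div_iff₀ hηlq0]
    nlinarith
  calc L₁ * P⁻¹ ≤ (4 * P / (η * Real.log q)) * P⁻¹ :=
        mul_le_mul_of_nonneg_right h1 (inv_nonneg.mpr hP0.le)
    _ = 4 / (η * Real.log q) := by
        field_simp

end Literature.NumberTheory.LFunctions.SiegelZero
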